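import Summits.QuantumFields.BalabanUV.Beta.RemainderExplicitGradient
import Summits.QuantumFields.BalabanUV.Beta.RemainderExplicitMultiplier

/-!
# Beta / RemainderExplicitUnits — BINDER-OWNERS row D4, ROAD P3 (co-owner #3, unit `b2b-balaban-beta-d4-p3`), skeleton leaf E4
# (first instalment): BAŁABAN-NORMALISED TEST CONFIGURATIONS `h := N^{d+2}·wH^{(N)}` (d + 1 = 4, `N = Lc^{j+1}`) AND THE
# LEVEL-UNIFORM BOUNDS OF THE FIRST TWO COMPONENTS OF THE (3.14)/(4.4) NORM IN η-UNITS: `sup|h|` and `|∇^η h| = N·|∇h|`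
# (+ the `𝒬ᵀΦ`-part of the third, `N²·N·|Φ^{Bal}|`), all `≤ C·e^{−κ₀·(block distance)}` with ONE `(κ₀, C)` for every level

HONEST FRAMING (page 1 of everything the β sub-cell writes): discharging `BetaPertH` makes Bałaban's UV stability
UNCONDITIONAL — a real constructive-QFT result; it is NOT the continuum limit and NOT the Clay problem.  HONEST DEPENDENCY
(verbatim): «continuum YM on T⁴ ⇐ BetaPertH ∧ nine spine estimates (0/9 proved); BetaPertH ⇐ (D1) ∧ (D4) ∧ CAP+tail;
G-an2-4 gates asym, D1 and NE2/3/4.»  NOT IN PRINT; OUR BOOKKEEPING.  `[folklore]` rescaling of three tree theorems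
(`GAN24.FineReadoutDecay.exists_wH_decay`, `RemainderExplicitGradient.exists_dwH_decay`,
`RemainderExplicitMultiplier.exists_wΦ_decay`) into Bałaban's η-lattice normalisation as READ in the cell note
`HOME/b2b-balaban-beta-d4-p3/UNITS-E4.md` ([Balaban1987RG1] (1.2) p. 260: continuum-normalised `𝐀`, `η = L^{−k}` in the exponent and in
`∇^η = η⁻¹·∇`; `AffineReproduction`: the block sum `𝒬` un-normalised, so `Q^{Bal} = N^{−(d+1)}·𝒬` and the response to a unit
AVERAGE source is `h = N^{d+2}·wH`).  The dictionary itself (that THIS `h` is [I] p. 282's `⟨δ𝐇_j(□₀,0)/δB, δ_x⟩` up to gauge) is the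
READING (R13-2)/(R14-1) carried by rows D1/D4 — NOT asserted here; this file only fixes the scalar factors as definitions and moves the
three bounds across them.  No cited fact, no wall binder.  NOT summit progress.

ABSOLUTE RULE (cell charter, verbatim): "No internally-minted statement may enter as a cited fact. Every hypothesis is
either kernel-proved in this package or a verbatim quotation of a PUBLISHED theorem with page reference. The manuscript(s)
under audit are NOT citable for their own disputed steps — they are the thing under adjudication; programme-internal
(2001/route/tribunal) claims are never citable."
-/

noncomputable section

open Literature.MathematicalPhysics.QuantumFieldTheory.LatticeForm (quo)
open Literature.MathematicalPhysics.QuantumFieldTheory.Balaban1983to89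
open Literature.MathematicalPhysics.QuantumFieldTheory.Balaban1983to89.Beta
open AffineAveraging (unitVec)
open B4ContourShift (supNorm)
open KernelSpecInstance (wH wΦ)
open Summit.QuantumFields.BalabanUV.Beta.GAN24.FineReadoutDecay (exists_wH_decay)
open Summit.QuantumFields.BalabanUV.Beta.RemainderExplicitGradient (exists_dwH_decay)
open Summit.QuantumFields.BalabanUV.Beta.RemainderExplicitMultiplier (exists_wΦ_decay)

namespace Summit.QuantumFields.BalabanUV.Beta.RemainderExplicitUnits

variable {Lc : ℕ} [NeZero Lc]

/-! ## §1 The dictionary's scalar factors as definitions (d + 1 = 4) -/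

/-- The block side at level `j`: `N_j = Lc^{j+1}` (= `η⁻¹ = L^k` of [Balaban1987RG1] (1.2) with `k = j + 1`), as a real number. [folklore] -/
def side (Lc j : ℕ) : ℝ := ((Lc ^ (j + 1) : ℕ) : ℝ)

/-- `side > 0`. [folklore] -/
theorem side_pos (j : ℕ) : 0 < side Lc j := by
  unfold side
  exact_mod_cast pow_pos (Nat.pos_of_ne_zero (NeZero.ne Lc)) _

/-- **BAŁABAN-NORMALISED TEST CONFIGURATION** (response of the typed `U = 1` minimiser to a unit AVERAGE source, d + 1 = 4):
`hBal j κ l z := N_j^5 · wH^{(N_j)} κ l z` (UNITS-E4 §3: `Q^{Bal} = N^{−5}·𝒬`). [folklore] -/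
def hBal (Lc : ℕ) [NeZero Lc] (j : ℕ) (κ l : Fin 4) (z : Fin 4 → ℤ) : ℝ :=
  haveI : NeZero (Lc ^ (j + 1)) := ⟨pow_ne_zero _ (NeZero.ne Lc)⟩
  side Lc j ^ 5 * wH (N := Lc ^ (j + 1)) κ l z

/-- **BAŁABAN-NORMALISED CONSTRAINT MULTIPLIER** of the same response: `phiBal j κ l y := N_j^5 · wΦ^{(N_j)} κ l y`. [folklore] -/
def phiBal (Lc : ℕ) [NeZero Lc] (j : ℕ) (κ l : Fin 4) (y : Fin 4 → ℤ) : ℝ :=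
  haveI : NeZero (Lc ^ (j + 1)) := ⟨pow_ne_zero _ (NeZero.ne Lc)⟩
  side Lc j ^ 5 * wΦ (N := Lc ^ (j + 1)) κ l y

/-! ## §2 The level-uniform bounds in η-units -/

/-- **COMPONENT `|𝐀|_X`: `sup|h|` IS LEVEL-FREE** — `|hBal j κ l z| ≤ C·e^{−κ₀‖quo_{N_j} z‖∞}` with ONE `(κ₀, C)` for every level
(`exists_wH_decay` × `N^5`). [folklore] -/
theorem exists_hBal_bound :
    ∃ κ₀ C : ℝ, 0 < κ₀ ∧ 0 ≤ C ∧ ∀ (j : ℕ) (κ l : Fin 4) (z : Fin 4 → ℤ),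
      |hBal Lc j κ l z| ≤ C * Real.exp (-(κ₀ * supNorm (quo (Lc ^ (j + 1)) z))) := by
  obtain ⟨κ₀, C, hκ₀, hC, h⟩ := exists_wH_decay (Lc := Lc)
  refine ⟨κ₀, C, hκ₀, hC, fun j κ l z => ?_⟩
  have hN : 0 < side Lc j := side_pos j
  have hb := h j κ l z
  unfold hBal
  rw [abs_mul, abs_of_pos (pow_pos hN 5)]
  calc side Lc j ^ 5 * |wH (N := Lc ^ (j + 1)) κ l z|
      ≤ side Lc j ^ 5 * (C * ((side Lc j) ^ 5)⁻¹ * Real.exp (-(κ₀ * supNorm (quo (Lc ^ (j + 1)) z)))) :=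
        mul_le_mul_of_nonneg_left hb (pow_nonneg hN.le 5)
    _ = C * Real.exp (-(κ₀ * supNorm (quo (Lc ^ (j + 1)) z))) := by
        field_simp

/-- **COMPONENT `|∇^η𝐀|_X`: `N·|∇h|` IS LEVEL-FREE** — `N_j·|hBal(z + e_ν) − hBal(z)| ≤ C·e^{−κ₀‖quo_{N_j} z‖∞}` with ONE `(κ₀, C)`
(`exists_dwH_decay` × `N^5·N`: the one `1/N` gained by the lattice curl is exactly the one the η-scaled difference spends). [folklore] -/
theorem exists_grad_hBal_bound :
    ∃ κ₀ C : ℝ, 0 < κ₀ ∧ 0 ≤ C ∧ ∀ (j : ℕ) (κ l ν : Fin 4) (z : Fin 4 → ℤ),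
      side Lc j * |hBal Lc j κ l (z + unitVec ν) - hBal Lc j κ l z|
        ≤ C * Real.exp (-(κ₀ * supNorm (quo (Lc ^ (j + 1)) z))) := by
  obtain ⟨κ₀, C, hκ₀, hC, h⟩ := exists_dwH_decay (Lc := Lc)
  refine ⟨κ₀, C, hκ₀, hC, fun j κ l ν z => ?_⟩
  have hN : 0 < side Lc j := side_pos j
  have hb := h j κ l ν z
  unfold hBal
  rw [← mul_sub, abs_mul, abs_of_pos (pow_pos hN 5), ← mul_assoc]
  calc side Lc j * side Lc j ^ 5 * |wH (N := Lc ^ (j + 1)) κ l (z + unitVec ν) - wH (N := Lc ^ (j + 1)) κ l z|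
      ≤ side Lc j * side Lc j ^ 5 *
          (C * ((side Lc j) ^ 5)⁻¹ * (side Lc j)⁻¹ * Real.exp (-(κ₀ * supNorm (quo (Lc ^ (j + 1)) z)))) :=
        mul_le_mul_of_nonneg_left hb (by positivity)
    _ = C * Real.exp (-(κ₀ * supNorm (quo (Lc ^ (j + 1)) z))) := by
        field_simp

/-- **THE `𝒬ᵀΦ`-PART OF COMPONENT `|Δ^η𝐀 − P₁𝐀|_X` IS LEVEL-FREE** — `N_j²·N_j·|phiBal j κ l y| ≤ C·e^{−κ₀‖y‖∞}` with ONE `(κ₀, C)`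
(`exists_wΦ_decay` × `N^5·N²·N`: `Δ^η = N²·Δ` and `𝒬ᵀ` sums `N` coarse values, UNITS-E4 §5; the `dΨ`- and `dd*`-parts are separate leaves).
[folklore] -/
theorem exists_phiBal_bound :
    ∃ κ₀ C : ℝ, 0 < κ₀ ∧ 0 ≤ C ∧ ∀ (j : ℕ) (κ l : Fin 4) (y : Fin 4 → ℤ),
      side Lc j ^ 2 * side Lc j * |phiBal Lc j κ l y| ≤ C * Real.exp (-(κ₀ * supNorm y)) := by
  obtain ⟨κ₀, C, hκ₀, hC, h⟩ := exists_wΦ_decay (Lc := Lc)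
  refine ⟨κ₀, C, hκ₀, hC, fun j κ l y => ?_⟩
  have hN : 0 < side Lc j := side_pos j
  have hb := h j κ l y
  unfold phiBal
  rw [abs_mul, abs_of_pos (pow_pos hN 5), ← mul_assoc]
  calc side Lc j ^ 2 * side Lc j * side Lc j ^ 5 * |wΦ (N := Lc ^ (j + 1)) κ l y|
      ≤ side Lc j ^ 2 * side Lc j * side Lc j ^ 5 *
          (C * ((side Lc j) ^ 5)⁻¹ * ((side Lc j) ^ 3)⁻¹ * Real.exp (-(κ₀ * supNorm y))) :=
        mul_le_mul_of_nonneg_left hb (by positivity)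
    _ = C * Real.exp (-(κ₀ * supNorm y)) := by
        field_simp

/-- **THE THREE TOGETHER WITH ONE PAIR OF CONSTANTS** (max of the constants, min of the rates): the shape in which skeleton leaf E3.4
assembles the (4.4)-norm bound of the restricted test configuration. [folklore] -/
theorem exists_uniform_bounds :
    ∃ κ₀ C : ℝ, 0 < κ₀ ∧ 0 ≤ C ∧
      (∀ (j : ℕ) (κ l : Fin 4) (z : Fin 4 → ℤ), |hBal Lc j κ l z| ≤ C * Real.exp (-(κ₀ * supNorm (quo (Lc ^ (j + 1)) z)))) ∧
      (∀ (j : ℕ) (κ l ν : Fin 4) (z : Fin 4 → ℤ),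
        side Lc j * |hBal Lc j κ l (z + unitVec ν) - hBal Lc j κ l z| ≤ C * Real.exp (-(κ₀ * supNorm (quo (Lc ^ (j + 1)) z)))) ∧
      (∀ (j : ℕ) (κ l : Fin 4) (y : Fin 4 → ℤ),
        side Lc j ^ 2 * side Lc j * |phiBal Lc j κ l y| ≤ C * Real.exp (-(κ₀ * supNorm y))) := by
  obtain ⟨κ₁, C₁, hκ₁, hC₁, h₁⟩ := exists_hBal_bound (Lc := Lc)
  obtain ⟨κ₂, C₂, hκ₂, hC₂, h₂⟩ := exists_grad_hBal_bound (Lc := Lc)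
  obtain ⟨κ₃, C₃, hκ₃, hC₃, h₃⟩ := exists_phiBal_bound (Lc := Lc)
  set κ₀ : ℝ := min κ₁ (min κ₂ κ₃) with hκ₀
  set C : ℝ := max C₁ (max C₂ C₃) with hC
  have hk1 : κ₀ ≤ κ₁ := min_le_left _ _
  have hk2 : κ₀ ≤ κ₂ := (min_le_right _ _).trans (min_le_left _ _)
  have hk3 : κ₀ ≤ κ₃ := (min_le_right _ _).trans (min_le_right _ _)
  have hc1 : C₁ ≤ C := le_max_left _ _
  have hc2 : C₂ ≤ C := (le_max_left _ _).trans (le_max_right _ _)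
  have hc3 : C₃ ≤ C := (le_max_right _ _).trans (le_max_right _ _)
  have hC0 : 0 ≤ C := hC₁.trans hc1
  -- weakening a bound `C' e^{-κ' t} ≤ C e^{-κ₀ t}` for `t ≥ 0`
  have weaken : ∀ {C' κ' t : ℝ}, C' ≤ C → κ₀ ≤ κ' → 0 ≤ t →
      C' * Real.exp (-(κ' * t)) ≤ C * Real.exp (-(κ₀ * t)) := by
    intro C' κ' t hC' hκ' ht
    have he : Real.exp (-(κ' * t)) ≤ Real.exp (-(κ₀ * t)) := Real.exp_le_exp.mpr (by nlinarith)
    calc C' * Real.exp (-(κ' * t)) ≤ C * Real.exp (-(κ' * t)) := mul_le_mul_of_nonneg_right hC' (Real.exp_nonneg _)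
      _ ≤ C * Real.exp (-(κ₀ * t)) := mul_le_mul_of_nonneg_left he hC0
  refine ⟨κ₀, C, lt_min hκ₁ (lt_min hκ₂ hκ₃), hC0, fun j κ l z => ?_, fun j κ l ν z => ?_, fun j κ l y => ?_⟩
  · exact (h₁ j κ l z).trans (weaken hc1 hk1 (B4ContourShift.supNorm_nonneg _))
  · exact (h₂ j κ l ν z).trans (weaken hc2 hk2 (B4ContourShift.supNorm_nonneg _))
  · exact (h₃ j κ l y).trans (weaken hc3 hk3 (B4ContourShift.supNorm_nonneg _))

end Summit.QuantumFields.BalabanUV.Beta.RemainderExplicitUnits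

end
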